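import Mathlib
import Literature.Computability.Complexity.BinomialTV
import Summits.PneNP.PneNP.Theorems.OneSliceBandImpliesThresholdBinomial

/-!
# Crux `MonotoneSuffices` (stmt-PneNP-18026), line `slice-transport` — stub `stub_transport`, part 3:
# binomial estimates for the transport

With `b N j = C(N, j)/2^N` (`BinomialTV.b`), the deletion count of the transport is mixed with the
weights `λ(d) = b N (m⋆ - d)`; the estimates consumed by the averaging argument are:

* `sum_abs_b_shift_le` — **the planted slice profile is close to the null one**:
  `∑_t |b N (t + K) - b (N - K) t| ≤ K / √(N - K + 1)` (`K ≤ N`): Pascal telescoping in `K` steps,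
  each costing the largest point mass (`BinomialTV.sum_abs_b_sub_b_succ_le`, `b_le_inv_sqrt`);
* `sum_b_filter_le` — Chebyshev for the symmetric binomial: the weights of the indices at distance
  `≥ t` from `N/2` sum to `≤ N/(4t²)` (`binomialWeight_tail_le` at `p = 1/2`);
* `one_sub_choose_ratio_le` — a uniformly random `d`-subset of an `m`-set meets a fixed `κ`-subset
  with probability `1 - C(m-κ,d)/C(m,d) ≤ κ d / m` (union bound).
-/

set_option linter.dupNamespace false -- `Summit.PneNP.PneNP.…`: summit = sub-problem name (D-0017 single-conjunct layout)

namespace Summit.PneNP.PneNP.Theorems.MonotoneSuffices.SliceTransport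

open Finset Literature.Computability.Complexity.BinomialTV

/-! ### Shifted comparison of symmetric binomial laws -/

/-- One Pascal step, shifted: `∑_{t<R} |b (n+1) (t+i+1) - b n (t+i)| ≤ 1/√(n+1)`. [folklore] -/
theorem sum_abs_b_succ_shift_le (n i R : ℕ) :
    ∑ t ∈ range R, |b (n + 1) (t + i + 1) - b n (t + i)| ≤ 1 / Real.sqrt (n + 1) := by
  have h1 : ∀ t, |b (n + 1) (t + i + 1) - b n (t + i)| = |b n (t + i) - b n (t + i + 1)| / 2 := fun t => by
    rw [b_succ_succ, show (b n (t + i) + b n (t + i + 1)) / 2 - b n (t + i) = -((b n (t + i) - b n (t + i + 1)) / 2)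
      by ring, abs_neg, abs_div, abs_two]
  simp only [h1]
  rw [← sum_div]
  -- reindex `s = t + i` and enlarge the range
  have h2 : ∑ t ∈ range R, |b n (t + i) - b n (t + i + 1)| ≤ ∑ s ∈ range (R + i), |b n s - b n (s + 1)| := by
    have : ∑ t ∈ range R, |b n (t + i) - b n (t + i + 1)| = ∑ s ∈ Ico i (R + i), |b n s - b n (s + 1)| := by
      rw [range_eq_Ico, sum_Ico_add' (fun s => |b n s - b n (s + 1)|) 0 R i, zero_add, add_comm R i]
    rw [this]
    refine sum_le_sum_of_subset_of_nonneg (fun s hs => ?_) fun s _ _ => abs_nonneg _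
    rw [mem_Ico] at hs
    exact mem_range.2 (by omega)
  have h3 := sum_abs_b_sub_b_succ_le n (R + i)
  have h4 := b_le_inv_sqrt n (n / 2)
  have h5 := b_nonneg n 0
  have h6 := b_nonneg n (R + i)
  calc (∑ t ∈ range R, |b n (t + i) - b n (t + i + 1)|) / 2 ≤ (2 * b n (n / 2)) / 2 := by
        gcongr; linarith
    _ = b n (n / 2) := by ring
    _ ≤ 1 / Real.sqrt (n + 1) := h4

/-- **The planted slice profile is `ℓ₁`-close to the null one**: for `M` and every `i`, `R`,
`∑_{t<R} |b (M + i) (t + i) - b M t| ≤ i / √(M + 1)`. [folklore] -/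
theorem sum_abs_b_add_shift_le (M i R : ℕ) :
    ∑ t ∈ range R, |b (M + i) (t + i) - b M t| ≤ (i : ℝ) / Real.sqrt (M + 1) := by
  induction i with
  | zero => simp
  | succ i ih =>
    have htri : ∑ t ∈ range R, |b (M + (i + 1)) (t + (i + 1)) - b M t| ≤
        ∑ t ∈ range R, |b (M + i + 1) (t + i + 1) - b (M + i) (t + i)| +
          ∑ t ∈ range R, |b (M + i) (t + i) - b M t| := by
      rw [← sum_add_distrib]
      refine sum_le_sum fun t _ => ?_
      rw [show M + (i + 1) = M + i + 1 by ring, show t + (i + 1) = t + i + 1 by ring]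
      exact abs_sub_le _ _ _
    have hstep : ∑ t ∈ range R, |b (M + i + 1) (t + i + 1) - b (M + i) (t + i)| ≤ 1 / Real.sqrt (M + 1) :=
      calc _ ≤ 1 / Real.sqrt ((M + i : ℕ) + 1) := sum_abs_b_succ_shift_le (M + i) i R
        _ ≤ 1 / Real.sqrt (M + 1) := by
            gcongr
            linarith
    calc _ ≤ 1 / Real.sqrt (M + 1) + (i : ℝ) / Real.sqrt (M + 1) := htri.trans (add_le_add hstep ih)
      _ = ((i + 1 : ℕ) : ℝ) / Real.sqrt (M + 1) := by push_cast; ring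

/-- **Shifted comparison, crux form**: for `K ≤ N`,
`∑_{t<R} |b N (t + K) - b (N - K) t| ≤ K / √(N - K + 1)`. [folklore] -/
theorem sum_abs_b_shift_le {N K : ℕ} (hK : K ≤ N) (R : ℕ) :
    ∑ t ∈ range R, |b N (t + K) - b (N - K) t| ≤ (K : ℝ) / Real.sqrt ((N - K : ℕ) + 1) := by
  have h := sum_abs_b_add_shift_le (N - K) K R
  rwa [Nat.sub_add_cancel hK] at h

/-! ### Chebyshev for the symmetric binomial law -/

/-- `b N i = C(N,i) (1/2)^i (1/2)^{N-i}`. [folklore] -/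
theorem b_eq_weight (N i : ℕ) : b N i = (N.choose i : ℝ) * (1 / 2) ^ i * (1 - 1 / 2) ^ (N - i) := by
  unfold b
  rcases le_or_gt i N with h | h
  · rw [show (1 - 1 / 2 : ℝ) = 1 / 2 by norm_num, mul_assoc, ← pow_add, Nat.add_sub_cancel' h,
      one_div_pow]
    ring
  · rw [Nat.choose_eq_zero_of_lt h]
    simp

/-- **Chebyshev for `Bin(N, 1/2)`**: the weights of the indices `i ≤ N` with `t ≤ |i - N/2|` sum to
at most `N/(4t²)` (`t > 0`). [folklore] -/
theorem sum_b_filter_le (N : ℕ) {t : ℝ} (ht : 0 < t) (P : ℕ → Prop) [DecidablePred P]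
    (hP : ∀ i, P i → t ≤ |(i : ℝ) - N / 2|) :
    ∑ i ∈ (range (N + 1)).filter P, b N i ≤ (N : ℝ) / 4 / t ^ 2 := by
  have h := binomialWeight_tail_le (N := N) (p := 1 / 2) (b := fun i => b N i) (fun i => b_eq_weight N i)
    (by norm_num) (by norm_num) ht P (fun i hi => by
      have := hP i hi
      rwa [show (N : ℝ) * (1 / 2) = N / 2 by ring])
  calc ∑ i ∈ (range (N + 1)).filter P, b N i ≤ (N : ℝ) * (1 / 2) * (1 - 1 / 2) / t ^ 2 := h
    _ = (N : ℝ) / 4 / t ^ 2 := by ring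

/-- The far-left tail: `∑_{j ≤ N, j + t ≤ N/2} b N j ≤ N/(4t²)` for a natural `t > 0`. [folklore] -/
theorem sum_b_le_of_add_le (N : ℕ) {t : ℕ} (ht : 0 < t) :
    ∑ j ∈ (range (N + 1)).filter (fun j => 2 * (j + t) ≤ N), b N j ≤ (N : ℝ) / 4 / (t : ℝ) ^ 2 := by
  refine sum_b_filter_le N (by exact_mod_cast ht) _ fun j hj => ?_
  have : (2 : ℝ) * ((j : ℝ) + t) ≤ N := by exact_mod_cast hj
  rw [abs_sub_comm, abs_of_nonneg (by linarith)]
  linarith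

/-- The right tail: `∑_{j ≤ N, ⌊N/2⌋ + t ≤ j} b N j ≤ N/t²` for a natural `t > 0` (the deviation
from the real mean `N/2` is `≥ t - 1/2 ≥ t/2`). [folklore] -/
theorem sum_b_le_of_half_add_le (N : ℕ) {t : ℕ} (ht : 0 < t) :
    ∑ j ∈ (range (N + 1)).filter (fun j => N / 2 + t ≤ j), b N j ≤ (N : ℝ) / (t : ℝ) ^ 2 := by
  have ht1 : (1 : ℝ) ≤ t := by exact_mod_cast ht
  have h4 : (N : ℝ) / 2 ≤ ((N / 2 : ℕ) : ℝ) + 1 / 2 := by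
    have h8 : (N : ℝ) = 2 * ((N / 2 : ℕ) : ℝ) + ((N % 2 : ℕ) : ℝ) := by exact_mod_cast (Nat.div_add_mod N 2).symm
    have h9 : ((N % 2 : ℕ) : ℝ) ≤ 1 := by exact_mod_cast Nat.lt_succ_iff.1 (Nat.mod_lt N (by norm_num))
    linarith
  calc ∑ j ∈ (range (N + 1)).filter (fun j => N / 2 + t ≤ j), b N j ≤ (N : ℝ) / 4 / ((t : ℝ) / 2) ^ 2 := by
        refine sum_b_filter_le N (by linarith) _ fun j hj => ?_
        have h3 : ((N / 2 : ℕ) : ℝ) + t ≤ j := by exact_mod_cast hj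
        rw [abs_of_nonneg (by linarith)]
        linarith
    _ = (N : ℝ) / (t : ℝ) ^ 2 := by
        field_simp
        ring

/-! ### A random `d`-subset rarely meets a small protected set -/

/-- Supersets of one fixed element among the `d`-subsets of `s` number at most `C(#s - 1, d - 1)`.
[folklore] -/
theorem card_filter_powersetCard_mem_le {β : Type*} [DecidableEq β] (s : Finset β) {e : β} (he : e ∈ s)
    (d : ℕ) : #((s.powersetCard d).filter fun D => e ∈ D) ≤ (#s - 1).choose (d - 1) := by
  classical
  have hT : ({e} : Finset β) ⊆ s := singleton_subset_iff.2 he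
  rw [← card_singleton e, ← card_sdiff_of_subset hT, ← card_powersetCard]
  refine card_le_card_of_injOn (fun D => D \ {e}) (fun D hD => ?_) (fun D₁ hD₁ D₂ hD₂ h => ?_)
  · simp only [coe_filter, Set.mem_setOf_eq, mem_powersetCard] at hD
    rw [mem_coe, mem_powersetCard]
    refine ⟨sdiff_subset_sdiff hD.1.1 Subset.rfl, ?_⟩
    rw [card_sdiff_of_subset (singleton_subset_iff.2 hD.2), hD.1.2, card_singleton]
  · simp only [coe_filter, Set.mem_setOf_eq, mem_powersetCard] at hD₁ hD₂
    have := congrArg (fun D => D ∪ {e}) h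
    simp only [sdiff_union_of_subset (singleton_subset_iff.2 hD₁.2),
      sdiff_union_of_subset (singleton_subset_iff.2 hD₂.2)] at this
    exact this

/-- **Union bound**: the `d`-subsets of `s` meeting `K ⊆ s` number at most `#K · C(#s - 1, d - 1)`,
i.e. `C(#s, d) - C(#s - #K, d) ≤ #K · C(#s - 1, d - 1)`. [folklore] -/
theorem choose_sub_choose_le_mul {β : Type*} [DecidableEq β] (s K : Finset β) (hK : K ⊆ s) (d : ℕ) :
    (#s).choose d - (#s - #K).choose d ≤ #K * (#s - 1).choose (d - 1) := by
  classical
  -- the `d`-subsets meeting `K`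
  have hsplit : (#s).choose d - (#s - #K).choose d = #((s.powersetCard d).filter fun D => ¬ Disjoint D K) := by
    have h1 : #((s.powersetCard d).filter fun D => Disjoint D K) = (#s - #K).choose d := by
      have : (s.powersetCard d).filter (fun D => Disjoint D K) = (s \ K).powersetCard d := by
        ext D
        simp only [mem_filter, mem_powersetCard, subset_sdiff, and_comm, and_left_comm]
      rw [this, card_powersetCard, card_sdiff_of_subset hK]
    have h2 := Finset.card_filter_add_card_filter_not (s := s.powersetCard d) (fun D => Disjoint D K)
    rw [card_powersetCard, h1] at h2
    omega
  rw [hsplit]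
  calc #((s.powersetCard d).filter fun D => ¬ Disjoint D K)
      ≤ #(K.biUnion fun e => (s.powersetCard d).filter fun D => e ∈ D) := by
        refine card_le_card fun D hD => ?_
        rw [mem_filter, not_disjoint_iff] at hD
        obtain ⟨hD, e, heD, heK⟩ := hD
        exact mem_biUnion.2 ⟨e, heK, mem_filter.2 ⟨hD, heD⟩⟩
    _ ≤ ∑ e ∈ K, #((s.powersetCard d).filter fun D => e ∈ D) := card_biUnion_le
    _ ≤ ∑ _e ∈ K, (#s - 1).choose (d - 1) := sum_le_sum fun e he => card_filter_powersetCard_mem_le s (hK he) d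
    _ = #K * (#s - 1).choose (d - 1) := by rw [sum_const, smul_eq_mul]

/-- **A uniformly random `d`-subset of an `m`-set meets a fixed `κ`-subset with probability at most
`κ d / m`**: `1 - C(m - κ, d)/C(m, d) ≤ κ d / m` for `κ ≤ m`, `d ≤ m`, `1 ≤ m`. [folklore] -/
theorem one_sub_choose_ratio_le {m κ d : ℕ} (hκ : κ ≤ m) (hd : d ≤ m) (hm : 1 ≤ m) :
    1 - (((m - κ).choose d : ℕ) : ℝ) / ((m.choose d : ℕ) : ℝ) ≤ (κ : ℝ) * d / m := by
  rcases Nat.eq_zero_or_pos d with rfl | hd0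
  · simp
  have hpos : 0 < m.choose d := Nat.choose_pos hd
  have hposR : (0 : ℝ) < m.choose d := by exact_mod_cast hpos
  -- counting form on `s = range m`, `K = range κ`
  have hcount := choose_sub_choose_le_mul (range m) (range κ) (range_subset_range.2 hκ) d
  rw [card_range, card_range] at hcount
  have hle : (m - κ).choose d ≤ m.choose d := Nat.choose_le_choose d (Nat.sub_le m κ)
  -- `m · C(m-1, d-1) = d · C(m, d)`
  have hid : m * (m - 1).choose (d - 1) = m.choose d * d := by
    obtain ⟨m', rfl⟩ : ∃ m', m = m' + 1 := ⟨m - 1, by omega⟩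
    obtain ⟨d', rfl⟩ : ∃ d', d = d' + 1 := ⟨d - 1, by omega⟩
    simpa using Nat.add_one_mul_choose_eq m' d'
  have hmR : (0 : ℝ) < m := by exact_mod_cast hm
  rw [sub_le_iff_le_add, div_add_div _ _ hmR.ne' hposR.ne', le_div_iff₀ (mul_pos hmR hposR), one_mul]
  have h1 : ((m.choose d : ℕ) : ℝ) - ((m - κ).choose d : ℕ) ≤ (κ : ℝ) * (m - 1).choose (d - 1) := by
    have := Nat.sub_le_iff_le_add.1 hcount
    have h2 : ((m.choose d : ℕ) : ℝ) ≤ (κ * (m - 1).choose (d - 1) : ℕ) + ((m - κ).choose d : ℕ) := by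
      exact_mod_cast (by omega : m.choose d ≤ κ * (m - 1).choose (d - 1) + (m - κ).choose d)
    push_cast at h2
    linarith
  have h3 : (κ : ℝ) * (m - 1).choose (d - 1) * m = κ * d * (m.choose d) := by
    have := congrArg (Nat.cast (R := ℝ)) hid
    push_cast at this
    calc (κ : ℝ) * (m - 1).choose (d - 1) * m = κ * ((m : ℝ) * (m - 1).choose (d - 1)) := by ring
      _ = κ * ((m.choose d : ℝ) * d) := by rw [this]
      _ = κ * d * (m.choose d) := by ring
  nlinarith [h1, h3, hposR, hmR]

/-- **transport_binomial** (registered helper sub-goal of stmt-PneNP-18026 for `stub_transport`,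
part 3): the shifted `ℓ₁`-comparison of symmetric binomial laws (`sum_abs_b_shift_le`). [folklore] -/
theorem transport_binomial :
    ∀ {N K : ℕ}, K ≤ N → ∀ R : ℕ, ∑ t ∈ Finset.range R, |Literature.Computability.Complexity.BinomialTV.b N (t + K) - Literature.Computability.Complexity.BinomialTV.b (N - K) t| ≤ (K : ℝ) / Real.sqrt ((N - K : ℕ) + 1) :=
  fun hK R => sum_abs_b_shift_le hK R

end Summit.PneNP.PneNP.Theorems.MonotoneSuffices.SliceTransport
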